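import Summits.CriticalPhenomena.CardyFormulaZ2.Theses.CardySelfRefinement
import Literature.Probability.RandomPlanarGeometry.HullComplement
import HarnessLib

/-!
# The arc dichotomy for same-carrier Dobrushin domains: sub-goal `stub_carrierDetermines_arcDichotomy`
# of stub `stub_carrierDetermines` of line `crosscut-dictionary` for crux `LagHandOff`
# (stmt-CriticalPhenomena-10268)

Partial helper (geometric half) for the registered stub `stub_carrierDetermines` (namespace
`Summit.CriticalPhenomena.CardyFormulaZ2.Cruxes.LagHandOff.CrosscutDictionary`).  A
`DobrushinDomain` is a Jordan domain GIVEN WITH its boundary loop and two marks; two Dobrushin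
domains `D`, `D'` with the same carrier and the same marked points `a = pt 0`, `b = pt 1` may
differ by an orientation preserving or REVERSING reparametrisation of the loop.  We prove the
dichotomy `stub_carrierDetermines_arcDichotomy`: their boundary arcs agree as sets,
`D'.arc 0 = D.arc 0 ∧ D'.arc 1 = D.arc 1` (co-oriented), or are swapped,
`D'.arc 0 = D.arc 1 ∧ D'.arc 1 = D.arc 0` (orientation reversed); and the resulting reduction
`eq_of_coOriented_of_reversed` of "depends on `(carrier, a, b)` only" to a co-oriented half and an
arc-swapped half, for any function of Dobrushin domains.

Proof.  Same carrier and marks make `D'` a hull complement of `D` on either side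
(`DobrushinDomain.isHullComplement_of_carrier_eq`, `HullComplement.lean`), so each arc `D.arc j`
IS an arc `D'.arc (k j)` (`IsHullComplement.exists_arc_eq`: the open arc is connected inside
`∂D' ∖ {a, b}`, sub-arc lemma); `k 0 ≠ k 1` because `D.arc 0 ≠ D.arc 1` (an interior point of
`arc 0` is off `arc 1`, `MarkedDomain.boundary_not_mem_arc`), and a permutation of `Fin 2` is the
identity or the swap.  References: W. Werner, *Lectures on two-dimensional critical percolation*
(2007), §2–3 (Dobrushin domains and their arcs); folklore.
-/

noncomputable section

open MeasureTheory Filter Set Topology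
open scoped BoundedContinuousFunction
open Literature.Probability.Percolation Literature.Probability.LatticeModels
open Literature.Probability.RandomPlanarGeometry Literature.Probability.Percolation.QuadCrossing
open Summit.CriticalPhenomena.CardyFormulaZ2.Theses.CardySelfRefinement

namespace Summit.CriticalPhenomena.CardyFormulaZ2.Cruxes.LagHandOff.CrosscutDictionary

/-- The two arcs of a Dobrushin domain are different sets (the midpoint of `arc 0` is off
`arc 1`). -/
theorem arc_zero_ne_arc_one (D : DobrushinDomain) : D.arc 0 ≠ D.arc 1 := fun h =>
  D.boundary_not_mem_arc (i := 0) (j := 1) (by decide) (D.midpoint_mem_Ioo 0)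
    (h ▸ ⟨_, Ioo_subset_Icc_self (D.midpoint_mem_Ioo 0), rfl⟩)

/-- Each arc of `D` is an arc of every same-carrier same-marks `D'`. -/
theorem exists_arc_eq_of_carrier_eq {D D' : DobrushinDomain} (hc : D'.carrier = D.carrier)
    (h0 : D'.pt 0 = D.pt 0) (h1 : D'.pt 1 = D.pt 1) (j : Fin 2) : ∃ k : Fin 2, D'.arc k = D.arc j :=
  (DobrushinDomain.isHullComplement_of_carrier_eq hc h0 h1 j).exists_arc_eq

/-! ### The arc dichotomy -/

/-- **Arc dichotomy** (sub-goal `stub_carrierDetermines_arcDichotomy` of `stub_carrierDetermines`).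
Two Dobrushin domains with the same carrier and the same marked points `a`, `b` have the same two
boundary arcs as sets, in the same order (co-oriented boundary loops) or swapped (orientation
reversed): each arc of `D` is an arc of `D'` (hull complement on both sides), the two arcs of
`D` are different, and a permutation of two indices is the identity or the swap. -/
theorem stub_carrierDetermines_arcDichotomy : ∀ D D' : DobrushinDomain, D'.carrier = D.carrier → D'.pt 0 = D.pt 0 → D'.pt 1 = D.pt 1 → (D'.arc 0 = D.arc 0 ∧ D'.arc 1 = D.arc 1) ∨ (D'.arc 0 = D.arc 1 ∧ D'.arc 1 = D.arc 0) := by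
  intro D D' hc h0 h1
  have hne := arc_zero_ne_arc_one D
  rcases Fin.exists_fin_two.1 (exists_arc_eq_of_carrier_eq hc h0 h1 0) with e0 | e0 <;>
    rcases Fin.exists_fin_two.1 (exists_arc_eq_of_carrier_eq hc h0 h1 1) with e1 | e1
  · exact absurd (e0.symm.trans e1) hne
  · exact Or.inl ⟨e0, e1⟩
  · exact Or.inr ⟨e1, e0⟩
  · exact absurd (e0.symm.trans e1) hne

/-- **Reduction of `stub_carrierDetermines` to its two halves.** A function of Dobrushin domains
that is unchanged when the domain is replaced by a same-carrier same-marks domain with the SAME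
arcs (co-oriented half) and by one with the arcs SWAPPED (reversed half) depends on the domain
only through `(carrier, a, b)`.  For the hand-off family `P D := (Ψ D)_* μ` of line
`crosscut-dictionary` the co-oriented half is `stub_carrierDetermines_coOriented` (E-blindness of
the hands-off) and the reversed half is the arc-swap (self-duality) statement. -/
theorem eq_of_coOriented_of_reversed {α : Sort*} (P : DobrushinDomain → α)
    (hco : ∀ D D' : DobrushinDomain, D'.carrier = D.carrier → D'.pt 0 = D.pt 0 → D'.pt 1 = D.pt 1 →
      D'.arc 0 = D.arc 0 → D'.arc 1 = D.arc 1 → P D' = P D)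
    (hrev : ∀ D D' : DobrushinDomain, D'.carrier = D.carrier → D'.pt 0 = D.pt 0 →
      D'.pt 1 = D.pt 1 → D'.arc 0 = D.arc 1 → D'.arc 1 = D.arc 0 → P D' = P D) :
    ∀ D D' : DobrushinDomain, D'.carrier = D.carrier → D'.pt 0 = D.pt 0 → D'.pt 1 = D.pt 1 →
      P D' = P D := by
  intro D D' hc h0 h1
  rcases stub_carrierDetermines_arcDichotomy D D' hc h0 h1 with ⟨ha0, ha1⟩ | ⟨ha0, ha1⟩
  · exact hco D D' hc h0 h1 ha0 ha1
  · exact hrev D D' hc h0 h1 ha0 ha1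

end Summit.CriticalPhenomena.CardyFormulaZ2.Cruxes.LagHandOff.CrosscutDictionary

end
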